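import Summits.QuantumFields.YangMills.Theorems.UnitScaleTiltProp7ProjectorPerturbation
import HarnessLib

/-!
# Route `UnitScaleTilt`, crux K1 «MinimiserStabilityRegPr» (stmt-QuantumFields-19200), EX row `hGF[Lift]` (curved member) — **LOD LINE, PEN (L5″) FILE 2r-door (ABSTRACT):
# THE (RN) GRAM-DIFFERENCE ROW BY A NEAR∕FAR SPLIT** — for a matrix `A` (member: `A = M′ − M`, the difference of the two Gram matrices) and a coarse vector `c` (member: `c = M′⁻¹b`),
# split `c = c_N + c_F` along a finite «near» index set `N` (the coarse points of the enlarged cube): `‖A c‖ ≤ ‖A c_N‖ + ‖A c_F‖ ≤ ε_N·‖c_N‖ + ‖A‖·‖c_F‖`, where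
# `ε_N` is the smallness of `A` ON VECTORS SUPPORTED IN `N` (both column systems agree near the cube, (RB)-type) and `‖c_F‖` is the TAIL of `c` outside `N` (exponential
# concentration, routeR-w2 ✓`Prop7CoarseGramInverseDecay`∕`…TdistDecay` + ✓`Prop7ComplementaryProjectorBlockDecay`).  Output = the `hrow` of ✓`Prop7GramInverseDifferenceRow.gramInv_difference_row`.

Cell `ym3-torus` (HUMAN RULING D-0037, YM ladder rung R3 — NOT d = 4, NOT infinite volume, NOT a mass gap, NOT Clay).  Width seat `ym-routeR-w3` gen 12; ★p1 g24 LOCATE-L6-ASSEMBLY §1 Step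
I.2 (L5″), road (α); routeR-w2 g12's «RN-sum» offer (2026-08-30 01:28:50Z, seat ■ 01:41:48Z) in its simplest near∕far form.  THEOREMS ONLY (0 `def`, 0 `sorry`), Mathlib + ✓`Prop7ProjectorPerturbation`
(`sqrt_normSq_mulVec_le`, `sqrt_sum_normSq_eq_norm_toLp`); `--supports stmt-QuantumFields-19200 --as helper`, count-neutral.  HONEST LABEL (★★OWNER RULING №33 (6)): curved γ-row supplier line,
pen (L5″); ℓ² bookkeeping — the near smallness and the far tail are px5 g11's member rows; nothing of (3.49), Thm 3.1∕3.3, `h349`, `hGF`, EX ∕ 19200 is proved here.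

WHAT IS PROVED (ns `Summit.QuantumFields.YangMills.Theorems.Prop7GramDifferenceNearFarSplit`; `‖·‖` on matrices = Mathlib's `L²`-operator norm; masks written with `if y ∈ N then … else 0`).
* `mask_add_mask_compl` (`c = c_N + c_F`), `sqrt_normSq_mask_le` (`‖c_N‖ ≤ ‖c‖`), `sqrt_normSq_add_le` (ℓ² triangle inequality in `Real.sqrt` currency).
* ★★★ `sqrt_normSq_mulVec_le_near_far` (`‖A c‖ ≤ ε_N·‖c_N‖ + ‖A‖·‖c_F‖` from the near-operator row), ★★ `gramDifference_row_of_near_far` (with `‖c_N‖ ≤ ‖c‖ ≤ γ·‖f‖`, `‖c_F‖ ≤ τ·‖f‖`,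
  `‖A‖ ≤ C_A`: `‖A c‖ ≤ (ε_N·γ + C_A·τ)·‖f‖` — the `hrow` of ✓`gramInv_difference_row` with `δ_M := ε_N·γ + C_A·τ`).

References: T. Bałaban, CMP **99** (1985) 389–434 [Balaban1985BackgroundPropagators] ((3.22)–(3.23) p.394, (3.49) p.399, (3.105) p.414).
-/

set_option autoImplicit false

noncomputable section

open scoped BigOperators Matrix Matrix.Norms.L2Operator

namespace Summit.QuantumFields.YangMills.Theorems.Prop7GramDifferenceNearFarSplit

open Summit.QuantumFields.YangMills.Theorems.Prop7ProjectorPerturbation (sqrt_normSq_mulVec_le sqrt_sum_normSq_eq_norm_toLp)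

variable {m : Type*} [Fintype m] [DecidableEq m]

omit [Fintype m] in
/-- `c = c_N + c_F` for the masks along `N` and its complement. [folklore] -/
theorem mask_add_mask_compl (N : Finset m) (c : m → ℂ) :
    (fun y => if y ∈ N then c y else 0) + (fun y => if y ∈ N then 0 else c y) = c := by
  funext y; by_cases hy : y ∈ N <;> simp [hy]

omit [DecidableEq m] in
/-- A mask does not increase the `ℓ²` norm: `√Σ‖(c_N)_y‖² ≤ √Σ‖c_y‖²` (either mask). [folklore] -/
theorem sqrt_normSq_mask_le (c : m → ℂ) (P : m → Prop) [DecidablePred P] :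
    Real.sqrt (∑ y, ‖(if P y then c y else 0)‖ ^ 2) ≤ Real.sqrt (∑ y, ‖c y‖ ^ 2) := by
  refine Real.sqrt_le_sqrt (Finset.sum_le_sum fun y _ => ?_)
  by_cases hy : P y <;> simp [hy]

omit [DecidableEq m] in
/-- The `ℓ²` triangle inequality in `Real.sqrt` currency: `√Σ‖(u + w)_y‖² ≤ √Σ‖u_y‖² + √Σ‖w_y‖²`. [folklore] -/
theorem sqrt_normSq_add_le (u w : m → ℂ) :
    Real.sqrt (∑ y, ‖(u + w) y‖ ^ 2) ≤ Real.sqrt (∑ y, ‖u y‖ ^ 2) + Real.sqrt (∑ y, ‖w y‖ ^ 2) := by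
  rw [sqrt_sum_normSq_eq_norm_toLp, sqrt_sum_normSq_eq_norm_toLp, sqrt_sum_normSq_eq_norm_toLp, WithLp.toLp_add]
  exact norm_add_le _ _

/-- ★★★ **NEAR∕FAR SPLIT**: if `A` is `ε_N`-small on vectors supported in `N` (`∀ d, (∀ y ∉ N, d_y = 0) → ‖A d‖ ≤ ε_N‖d‖`), then for every `c`,
`‖A c‖ ≤ ε_N·‖c_N‖ + ‖A‖·‖c_F‖` (`c_N`, `c_F` the masks of `c` on `N` and off `N`; `ℓ²` norms as `Real.sqrt` sums). [cite: Balaban1985BackgroundPropagators, (3.105) p.414] -/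
theorem sqrt_normSq_mulVec_le_near_far (A : Matrix m m ℂ) (N : Finset m) (c : m → ℂ) {εN : ℝ}
    (hnear : ∀ d : m → ℂ, (∀ y, y ∉ N → d y = 0) → Real.sqrt (∑ y, ‖(A *ᵥ d) y‖ ^ 2) ≤ εN * Real.sqrt (∑ y, ‖d y‖ ^ 2)) :
    Real.sqrt (∑ y, ‖(A *ᵥ c) y‖ ^ 2)
      ≤ εN * Real.sqrt (∑ y, ‖(if y ∈ N then c y else 0)‖ ^ 2) + ‖A‖ * Real.sqrt (∑ y, ‖(if y ∈ N then (0 : ℂ) else c y)‖ ^ 2) := by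
  set cN : m → ℂ := fun y => if y ∈ N then c y else 0 with hcN
  set cF : m → ℂ := fun y => if y ∈ N then 0 else c y with hcF
  have hsplit : A *ᵥ c = A *ᵥ cN + A *ᵥ cF := by rw [← Matrix.mulVec_add, hcN, hcF, mask_add_mask_compl]
  rw [hsplit]
  refine (sqrt_normSq_add_le _ _).trans (add_le_add ?_ (sqrt_normSq_mulVec_le A cF))
  exact hnear cN fun y hy => by simp [hcN, hy]

/-- ★★ **THE (RN) GRAM-DIFFERENCE ROW FROM NEAR SMALLNESS + FAR TAIL**: with the near-operator row (`ε_N`), `‖A‖ ≤ C_A`, the size `‖c‖ ≤ γ·Nf` and the tail `‖c_F‖ ≤ τ·Nf`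
(`Nf = ‖f‖` at the member): **`‖A c‖ ≤ (ε_N·γ + C_A·τ)·Nf`** — the hypothesis `hrow` of ✓`Prop7GramInverseDifferenceRow.gramInv_difference_row` (`A := M′ − M`, `c := M′⁻¹b`).
[cite: Balaban1985BackgroundPropagators, (3.22)–(3.23) p.394, (3.105) p.414] -/
theorem gramDifference_row_of_near_far (A : Matrix m m ℂ) (N : Finset m) (c : m → ℂ) {εN CA γ τ Nf : ℝ} (hεN : 0 ≤ εN)
    (hnear : ∀ d : m → ℂ, (∀ y, y ∉ N → d y = 0) → Real.sqrt (∑ y, ‖(A *ᵥ d) y‖ ^ 2) ≤ εN * Real.sqrt (∑ y, ‖d y‖ ^ 2))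
    (hA : ‖A‖ ≤ CA) (hc : Real.sqrt (∑ y, ‖c y‖ ^ 2) ≤ γ * Nf) (htail : Real.sqrt (∑ y, ‖(if y ∈ N then (0 : ℂ) else c y)‖ ^ 2) ≤ τ * Nf) :
    Real.sqrt (∑ y, ‖(A *ᵥ c) y‖ ^ 2) ≤ (εN * γ + CA * τ) * Nf := by
  have h := sqrt_normSq_mulVec_le_near_far A N c hnear
  have hN : Real.sqrt (∑ y, ‖(if y ∈ N then c y else 0)‖ ^ 2) ≤ γ * Nf := (sqrt_normSq_mask_le c (· ∈ N)).trans hc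
  calc Real.sqrt (∑ y, ‖(A *ᵥ c) y‖ ^ 2)
      ≤ εN * Real.sqrt (∑ y, ‖(if y ∈ N then c y else 0)‖ ^ 2) + ‖A‖ * Real.sqrt (∑ y, ‖(if y ∈ N then (0 : ℂ) else c y)‖ ^ 2) := h
    _ ≤ εN * (γ * Nf) + CA * (τ * Nf) :=
        add_le_add (mul_le_mul_of_nonneg_left hN hεN) (mul_le_mul hA htail (Real.sqrt_nonneg _) ((norm_nonneg _).trans hA))
    _ = (εN * γ + CA * τ) * Nf := by ring

end Summit.QuantumFields.YangMills.Theorems.Prop7GramDifferenceNearFarSplit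

end
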